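import Literature.AlgebraicGeometry.GroupSchemes.ConnectedFactorsThroughUnitComponent   -- ★ (o-c2d): `existsUnique_fac_hom`, `isMonHom_of_comp`
import Literature.AlgebraicGeometry.GroupSchemes.EtaleComplementSplitsUnitComponent    -- ★ (o-c3j): `subsingleton_of_isFinite_of_connectedSpace`
import Literature.AlgebraicGeometry.GroupSchemes.BarsottiTateGroupHom                  -- ★ `BTGroup`, `BTGroup.Hom` (§2 only)
import HarnessLib

/-!
# The unit component of a kernel is the kernel on the unit component

Topic `Literature/AlgebraicGeometry/GroupSchemes`; namespace `Literature.AlgebraicGeometry.GroupSchemes` (§1 in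
`…GroupSchemes.UnitComponent`, §2 in `…GroupSchemes.BTGroup`).  THEOREMS ONLY (no definition, no instance, no notation, no named
fact, no `sorry`).  Cell `hodgecm-mathlib` (D-0151 ∕ D-0183 floor 0), P6 «MOD programme», sub-line P6b, kit «ONE-DIMENSIONAL BLOCK
NUMERICS» `Cruxes/HLiu418/Lines/F0_P6b_BlockNumerics.lean` (desk F0P6b-plan (g2), cut of record 2026-09-01T17:07Z): this file is the
generic organ that PAYS the registered stub `stub_N1b_unitComponentOfKernel` BY NAME (§2 restates it token for token over the
`BTGroup` currency; §1 is the layer-free statement).  Generic, count-neutral capital `--supports stmt-HodgeConjecture-24832`.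
HONEST LABEL: HC_CM is proved only modulo the printed citations until rung 0 closes; this file pays no letter.

## Mathematics

Let `k` be a field, `P` a `k`-group scheme, `ι₀ : P₀ ↪ P` a homomorphism whose underlying map is an OPEN AND CLOSED immersion
with CONNECTED source, `P₀` FINITE over `k` (so `P₀` is a one-point space — a «unit component» in the sense of the P6b sub-line),
`φ : P → P` and `φ₀ : P₀ → P₀` with `φ₀ ≫ ι₀ = ι₀ ≫ φ` («`φ` restricts to `φ₀`»), `ιG : G ↪ P` a closed homomorphic immersion
representing the kernel of `φ` on `T`-points (`t ≫ φ = 1 ↔ t` factors through `ιG`), and `jU : U ↪ G` a unit component of `G`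
(homomorphism, open and closed immersion, connected source).  Then there is `u : U → P₀` with

* `u` a homomorphism and a closed immersion, `u ≫ ι₀ = jU ≫ ιG` — the connected `U` maps into the clopen `P₀`
  ([Tate1997FiniteFlatGroupSchemes] (3.7): ★ `existsUnique_fac_hom`), the factor is a homomorphism because `ι₀` is mono
  (★ `isMonHom_of_comp`) and a closed immersion because `u ≫ ι₀` is;
* `u` represents the kernel of `φ₀` on `T`-points: if `t : T → P₀` has `t ≫ φ₀ = 1` then `(t ≫ ι₀) ≫ φ = t ≫ φ₀ ≫ ι₀ = 1`, so
  `t ≫ ι₀ = s′ ≫ ιG` for some `s′ : T → G`; every point of `T` goes under `s′` to a point of `G` lying over the SINGLE point of `P₀`,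
  i.e. (injectivity of `ιG`) to the unit point of `G`, which lies in the open `U` — so `s′` factors through the open immersion `jU`
  (Mathlib `IsOpenImmersion.lift`), and the factor composes with `u` to `t` (cancel the mono `ι₀`).  Conversely
  `u ≫ φ₀ ≫ ι₀ = jU ≫ ιG ≫ φ = 1`.

This is [SGA3-I] VI_A 2.3–2.4 ∕ [Tate1997FiniteFlatGroupSchemes] (3.7) «`(Ker φ)⁰ = Ker(φ|_{G⁰})⁰`» in the one-point (finite over a field)
situation, where `Ker(φ₀)` is automatically connected.

## References
* [Tate1997FiniteFlatGroupSchemes] J. Tate, *Finite flat group schemes*, in: Modular Forms and Fermat's Last Theorem (1997), (3.7).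
* [SGA3I] M. Demazure, A. Grothendieck, *SGA 3, Tome I*, Exp. VI_A, 2.3–2.4 (the unit component `G⁰`; behaviour under homomorphisms).
* [Tate1967] J. Tate, *p-divisible groups* (1967), §2 (2.1)–(2.4) (homomorphisms of Barsotti–Tate groups, the connected part).
-/

set_option autoImplicit false

noncomputable section

universe u

open CategoryTheory CategoryTheory.Limits AlgebraicGeometry MonoidalCategory CartesianMonoidalCategory
open scoped MonObj

namespace Literature.AlgebraicGeometry.GroupSchemes

/-! ## §1 Layer-free statement: kernels commute with passing to the unit component -/

namespace UnitComponent

variable {k : Type u} [Field k]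
variable {P P₀ G U : Over (Spec (.of k))} [GrpObj P] [GrpObj P₀] [GrpObj G] [GrpObj U]

/-- The unit point of a `k`-group scheme `G` lies in the image of any homomorphism `j : U ⟶ G` (it is the image of the unit
point of `U`). [cite: Tate1997FiniteFlatGroupSchemes, (3.7)] -/
theorem unit_apply_mem_range (j : U ⟶ G) [IsMonHom j] (s : ↥(𝟙_ (Over (Spec (.of k)))).left) :
    (η[G] : 𝟙_ _ ⟶ G).left s ∈ Set.range j.left :=
  ⟨(η[U] : 𝟙_ _ ⟶ U).left s, by
    change ((η[U] : 𝟙_ _ ⟶ U) ≫ j).left s = _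
    rw [IsMonHom.one_hom]⟩

/-- If `ι₀ : P₀ ⟶ P` is a homomorphism from a ONE-POINT group scheme and `ιG : G ⟶ P` is a homomorphism injective on points,
then every point of `G` mapping into the image of `ι₀` is the unit point of `G`; in particular it lies in the image of any
homomorphism `j : U ⟶ G`. [cite: Tate1997FiniteFlatGroupSchemes, (3.7)] -/
theorem mem_range_of_apply_mem_range [Subsingleton ↥P₀.left] (ι₀ : P₀ ⟶ P) [IsMonHom ι₀] (ιG : G ⟶ P) [IsMonHom ιG]
    (hinj : Function.Injective ιG.left) (j : U ⟶ G) [IsMonHom j] (x : ↥G.left)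
    (hx : ιG.left x ∈ Set.range ι₀.left) : x ∈ Set.range j.left := by
  haveI : Nonempty ↥(𝟙_ (Over (Spec (.of k)))).left := inferInstanceAs (Nonempty (PrimeSpectrum k))
  obtain ⟨s⟩ := (inferInstance : Nonempty ↥(𝟙_ (Over (Spec (.of k)))).left)
  obtain ⟨y, hy⟩ := hx
  -- `y` is the unit point of `P₀`, so `ιG x = ι₀ (e_{P₀}) = e_P = ιG (e_G)`.
  have hy' : y = (η[P₀] : 𝟙_ _ ⟶ P₀).left s := Subsingleton.elim _ _
  have h1 : ιG.left x = (η[P] : 𝟙_ _ ⟶ P).left s := by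
    rw [← hy, hy']
    change ((η[P₀] : 𝟙_ _ ⟶ P₀) ≫ ι₀).left s = _
    rw [IsMonHom.one_hom]
  have h2 : ιG.left ((η[G] : 𝟙_ _ ⟶ G).left s) = (η[P] : 𝟙_ _ ⟶ P).left s := by
    change ((η[G] : 𝟙_ _ ⟶ G) ≫ ιG).left s = _
    rw [IsMonHom.one_hom]
  have hxe : x = (η[G] : 𝟙_ _ ⟶ G).left s := hinj (h1.trans h2.symm)
  rw [hxe]
  exact unit_apply_mem_range j s

omit [GrpObj G] [GrpObj U] in
/-- A morphism `s′ : T ⟶ G` over `k` whose underlying map lands in the image of an open immersion `jU : U ⟶ G` factors through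
`jU` (Mathlib `IsOpenImmersion.lift`, dressed over the base). [cite: SGA3I, VI_A 2.3] -/
theorem exists_fac_of_range_subset {T : Over (Spec (.of k))} (jU : U ⟶ G) [IsOpenImmersion jU.left] (s' : T ⟶ G)
    (h : Set.range s'.left ⊆ Set.range jU.left) : ∃ s : T ⟶ U, s ≫ jU = s' := by
  let l : T.left ⟶ U.left := IsOpenImmersion.lift jU.left s'.left h
  have hl : l ≫ jU.left = s'.left := IsOpenImmersion.lift_fac jU.left s'.left h
  refine ⟨Over.homMk l (by rw [← Over.w jU, ← Category.assoc, hl, Over.w s']), ?_⟩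
  ext : 1
  exact hl

/-- **THE UNIT COMPONENT OF A KERNEL IS THE KERNEL ON THE UNIT COMPONENT** (layer-free form).  `ι₀ : P₀ ↪ P` a homomorphic
open-and-closed immersion with connected source, `P₀` finite over the field `k`; `φ₀ ≫ ι₀ = ι₀ ≫ φ`; `ιG : G ↪ P` a closed
homomorphic immersion representing `Ker φ` on `T`-points; `jU : U ↪ G` a unit component of `G` (homomorphism, open and closed
immersion, connected source).  Then some `u : U ⟶ P₀` is a homomorphic closed immersion with `u ≫ ι₀ = jU ≫ ιG` representing
`Ker φ₀` on `T`-points. [cite: Tate1997FiniteFlatGroupSchemes, (3.7)] [cite: SGA3I, VI_A 2.3–2.4] -/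
theorem exists_hom_kernel_of_unitComponent
    (ι₀ : P₀ ⟶ P) [IsMonHom ι₀] (hι₀ : IsOpenImmersion ι₀.left ∧ IsClosedImmersion ι₀.left ∧ ConnectedSpace ↥P₀.left)
    [IsFinite P₀.hom]
    (φ : P ⟶ P) (φ₀ : P₀ ⟶ P₀) (hφ : φ₀ ≫ ι₀ = ι₀ ≫ φ)
    (ιG : G ⟶ P) (hιG : IsMonHom ιG ∧ IsClosedImmersion ιG.left)
    (hker : ∀ ⦃T : Over (Spec (.of k))⦄ (t : T ⟶ P), t ≫ φ = 1 ↔ ∃ s : T ⟶ G, s ≫ ιG = t)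
    (jU : U ⟶ G) (hU : IsMonHom jU ∧ IsOpenImmersion jU.left ∧ IsClosedImmersion jU.left ∧ ConnectedSpace ↥U.left) :
    ∃ u : U ⟶ P₀, (IsMonHom u ∧ IsClosedImmersion u.left) ∧ u ≫ ι₀ = jU ≫ ιG ∧
      ∀ ⦃T : Over (Spec (.of k))⦄ (t : T ⟶ P₀), t ≫ φ₀ = 1 ↔ ∃ s : T ⟶ U, s ≫ u = t := by
  obtain ⟨hι₀o, hι₀c, hP₀⟩ := hι₀
  obtain ⟨hιGm, hιGc⟩ := hιG
  obtain ⟨hjUm, hjUo, hjUc, hUc⟩ := hU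
  haveI : Nonempty ↥(𝟙_ (Over (Spec (.of k)))).left := inferInstanceAs (Nonempty (PrimeSpectrum k))
  haveI : Subsingleton ↥P₀.left := subsingleton_of_isFinite_of_connectedSpace P₀.hom
  haveI : Mono ι₀ := Over.mono_of_mono_left _
  -- the kernel inclusion is killed by `φ`
  have hιGφ : ιG ≫ φ = 1 := (hker ιG).2 ⟨𝟙 G, Category.id_comp _⟩
  -- `U` connected maps into the clopen `P₀`
  obtain ⟨u, hu, -⟩ := existsUnique_fac_hom ι₀ (jU ≫ ιG)
  haveI : IsMonHom u := by
    haveI : IsMonHom (u ≫ ι₀) := by rw [hu]; infer_instance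
    exact isMonHom_of_comp ι₀ u
  have huc : IsClosedImmersion u.left := by
    haveI : IsClosedImmersion (u.left ≫ ι₀.left) := by
      rw [← Over.comp_left, hu, Over.comp_left]; infer_instance
    exact IsClosedImmersion.of_comp_isClosedImmersion u.left ι₀.left
  refine ⟨u, ⟨inferInstance, huc⟩, hu, fun T t => ⟨fun ht => ?_, ?_⟩⟩
  · -- `t ≫ φ₀ = 1` ⟹ `t ≫ ι₀` is killed by `φ` ⟹ factors through `ιG` ⟹ through `jU` (one-point argument) ⟹ through `u`
    have h1 : (t ≫ ι₀) ≫ φ = 1 := by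
      rw [Category.assoc, ← hφ, ← Category.assoc, ht, MonObj.one_comp]
    obtain ⟨s', hs'⟩ := (hker (t ≫ ι₀)).1 h1
    have hsub : Set.range s'.left ⊆ Set.range jU.left := by
      rintro _ ⟨x, rfl⟩
      refine mem_range_of_apply_mem_range ι₀ ιG ιG.left.isClosedEmbedding.injective jU (s'.left x) ⟨t.left x, ?_⟩
      change _ = (s' ≫ ιG).left x
      rw [hs']
      rfl
    obtain ⟨s, hs⟩ := exists_fac_of_range_subset jU s' hsub
    refine ⟨s, ?_⟩
    rw [← cancel_mono ι₀, Category.assoc, hu, ← Category.assoc, hs, hs']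
  · rintro ⟨s, rfl⟩
    have huφ₀ : u ≫ φ₀ = 1 := by
      rw [← cancel_mono ι₀, Category.assoc, hφ, ← Category.assoc, hu, Category.assoc, hιGφ, MonObj.comp_one,
        MonObj.one_comp]
    rw [Category.assoc, huφ₀, MonObj.comp_one]

end UnitComponent

/-! ## §2 The Barsotti–Tate currency: `stub_N1b_unitComponentOfKernel` token for token -/

namespace BTGroup

open Literature.AlgebraicGeometry.Motives (SchemeOver)

variable {k : Type u} [Field k] (p : ℕ)

/-- **`stub_N1b` — THE UNIT COMPONENT OF A KERNEL IS THE KERNEL ON THE UNIT COMPONENT**, in the currency of the kit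
`F0_P6b_BlockNumerics`: for an endomorphism `φ` of a Barsotti–Tate group `B` over a field restricting to `φ₀` on a Barsotti–Tate
group `B₀` along `ι₀ : B₀ → B` whose layer-`1` map is an open and closed immersion with connected source, the unit component `U` of
`G = Ker (φ.app 1)` (given through the sockets `ιG`, `hker`, `jU`) is carried by a homomorphic closed immersion `u` onto the kernel of
`φ₀.app 1` on `B₀.G 1` (`u ≫ ι₀.app 1 = jU ≫ ιG`, and `u` represents `Ker (φ₀.app 1)` on `T`-points).  One `exact` of §1.
[cite: Tate1997FiniteFlatGroupSchemes, (3.7)] [cite: Tate1967, §2 (2.1)–(2.4)] [cite: SGA3I, VI_A 2.3–2.4] -/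
theorem exists_hom_kernel_app_one_of_unitComponent {H H₀ : ℕ} (B : BTGroup (Spec (.of k)) p H)
    (B₀ : BTGroup (Spec (.of k)) p H₀) (ι₀ : BTGroup.Hom B₀ B)
    (hι₀ : IsOpenImmersion (ι₀.app 1).left ∧ IsClosedImmersion (ι₀.app 1).left ∧ ConnectedSpace ↥(B₀.G 1).left)
    (φ : BTGroup.Hom B B) (φ₀ : BTGroup.Hom B₀ B₀) (hφ : φ₀.comp ι₀ = ι₀.comp φ)
    (G : SchemeOver k) [GrpObj G] (ιG : G ⟶ B.G 1) (hιG : letI := B.grpObj 1; IsMonHom ιG ∧ IsClosedImmersion ιG.left)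
    (hker : letI := B.grpObj 1; ∀ ⦃T : SchemeOver k⦄ (t : T ⟶ B.G 1), t ≫ φ.app 1 = 1 ↔ ∃ s : T ⟶ G, s ≫ ιG = t)
    (U : SchemeOver k) [GrpObj U] (jU : U ⟶ G)
    (hU : IsMonHom jU ∧ IsOpenImmersion jU.left ∧ IsClosedImmersion jU.left ∧ ConnectedSpace ↥U.left) :
    ∃ u : U ⟶ B₀.G 1, (letI := B₀.grpObj 1; IsMonHom u ∧ IsClosedImmersion u.left) ∧ u ≫ ι₀.app 1 = jU ≫ ιG ∧
      (letI := B₀.grpObj 1; ∀ ⦃T : SchemeOver k⦄ (t : T ⟶ B₀.G 1), t ≫ φ₀.app 1 = 1 ↔ ∃ s : T ⟶ U, s ≫ u = t) := by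
  letI := B.grpObj 1
  letI := B₀.grpObj 1
  haveI : IsMonHom (ι₀.app 1) := ι₀.isMonHom_app 1
  haveI : IsFinite (B₀.G 1).hom := B₀.isFinite 1
  have hφ1 : φ₀.app 1 ≫ ι₀.app 1 = ι₀.app 1 ≫ φ.app 1 := by
    rw [← BTGroup.Hom.comp_app, ← BTGroup.Hom.comp_app, hφ]
  exact UnitComponent.exists_hom_kernel_of_unitComponent (ι₀.app 1) hι₀ (φ.app 1) (φ₀.app 1) hφ1 ιG hιG hker jU hU

end BTGroup

end Literature.AlgebraicGeometry.GroupSchemes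

end
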